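import Summits.ValiantsHypothesis.ValiantsHypothesis.Theorems.LacunarySymmetroidMatrixDescartesDoorA26WallBubblingMixGram

/-!
# Wall bubbling for `DoorA26` — THE STRATUM [3,2,1]: the ordered value classes (level-`ν` bookkeeping)

HONEST FRAMING.  Chain lemmas toward `TripleStratum26` of `Cruxes/DoorA26/Lines/wall_bubbling_ConfluentDoor.lean` (rev 13; crux `DoorA26`,
stmt-ValiantsHypothesis-19979 — OPEN, typed, never asserted), pattern [3,2,1] in the positions of chain `h321` of #91 `tripleStratum26_of_chains`:
PAIR at `0,1`, SINGLE at `2`, TRIPLE at `3,4,5`; value index `v = ![0,0,1,2,2,2] : Fin 6 → Fin 3`, value positions `![0,2,3] : Fin 3 → Fin 6`,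
classes `Fin 3 × Fin 3` (ordered), deviations `η_l = δ_l − δ_{pos (v l)}` (zero at `0, 2, 3`).  W1 seat val-sym-door-p2 g15 (#106); the [3,2,1]
twin of #87 / #95 / #102.  ALGEBRA ONLY (def-free):

* `weyl321_det_eq_memberSum` — `det Σ_l e^{δ_l t}U_l` as the 36-member sum with exponents split `(δ_{pos v p}+δ_{pos v q}) + (η_p+η_q)`;
* `weyl321_fib`, `weyl321_v_pos`, `sum_class_eq₃₂₁`, `weyl321_eta_pos`, `classMoment_swap₃₂₁` — fibres and class sums;
* `sum_fibPair`, `sum_fibSingle`, `sum_fibTriple` — the three fibres enumerated (`Fin 2` via `![0,1]`, the point `2`, `Fin 3` via `![3,4,5]`);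
* `pairMoment_symmetrise` — the four ordered members of a pair's own class have the moments of THREE weighted members (count for #81 `momentTail`).

Nothing here bears on `DoorA26`, `MatrixDescartes` (stmt-ValiantsHypothesis-18050) or `VP ≠ VNP`; `TripleStratum26`, (W), (M) OPEN.
`--supports stmt-ValiantsHypothesis-19979 --as helper`.  [this work].
-/

-- `Summit.ValiantsHypothesis.ValiantsHypothesis.…` repeats a component by the D-0017 layout
-- (single-conjunct summit), which the `dupNamespace` linter flags; the name is mandated.
set_option linter.dupNamespace false

namespace Summit.ValiantsHypothesis.ValiantsHypothesis.Theorems.LacunarySymmetroidMatrixDescartes.WallBubbling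

open Finset
open Bubbling (polar polar_apply det_sum_smul_fin_two)
open scoped BigOperators

/-! ## 1. The determinant as the member sum -/

/-- **The determinant as the ordered member sum** (pattern [3,2,1]), exponents split as class centre plus deviation. [this work] -/
theorem weyl321_det_eq_memberSum (δ : Fin 6 → ℝ) (U : Fin 6 → Matrix (Fin 2) (Fin 2) ℝ) (t : ℝ) :
    (∑ l, Real.exp (δ l * t) • U l).det
      = ∑ i : Fin 6 × Fin 6, polar (U i.1) (U i.2) *
          Real.exp (((δ ((![0, 2, 3] : Fin 3 → Fin 6) ((![0, 0, 1, 2, 2, 2] : Fin 6 → Fin 3) i.1))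
              + δ ((![0, 2, 3] : Fin 3 → Fin 6) ((![0, 0, 1, 2, 2, 2] : Fin 6 → Fin 3) i.2)))
            + ((δ i.1 - δ ((![0, 2, 3] : Fin 3 → Fin 6) ((![0, 0, 1, 2, 2, 2] : Fin 6 → Fin 3) i.1)))
              + (δ i.2 - δ ((![0, 2, 3] : Fin 3 → Fin 6) ((![0, 0, 1, 2, 2, 2] : Fin 6 → Fin 3) i.2))))) * t) := by
  rw [det_sum_smul_fin_two, Fintype.sum_prod_type]
  refine Finset.sum_congr rfl fun p _ => Finset.sum_congr rfl fun q _ => ?_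
  rw [← Real.exp_add]
  ring_nf

/-! ## 2. Fibres of the value index and class sums -/

/-- The fibres of the value index `v = ![0,0,1,2,2,2]`. [this work] -/
theorem weyl321_fib (a : Fin 3) :
    (univ.filter fun p : Fin 6 => (![0, 0, 1, 2, 2, 2] : Fin 6 → Fin 3) p = a)
      = if a = 0 then {0, 1} else if a = 1 then {2} else {3, 4, 5} := by
  fin_cases a <;> decide

/-- The value index of a value position is the value. [this work] -/
theorem weyl321_v_pos (a : Fin 3) : (![0, 0, 1, 2, 2, 2] : Fin 6 → Fin 3) ((![0, 2, 3] : Fin 3 → Fin 6) a) = a := by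
  fin_cases a <;> rfl

/-- A class sum over the ordered members is a double sum over the two fibres. [this work] -/
theorem sum_class_eq₃₂₁ (f : Fin 6 → Fin 6 → ℝ) (α β : Fin 3) :
    ∑ i : Fin 6 × Fin 6, (if ((![0, 0, 1, 2, 2, 2] : Fin 6 → Fin 3) i.1, (![0, 0, 1, 2, 2, 2] : Fin 6 → Fin 3) i.2) = (α, β)
        then f i.1 i.2 else 0)
      = ∑ p ∈ univ.filter (fun p : Fin 6 => (![0, 0, 1, 2, 2, 2] : Fin 6 → Fin 3) p = α),
          ∑ q ∈ univ.filter (fun q : Fin 6 => (![0, 0, 1, 2, 2, 2] : Fin 6 → Fin 3) q = β), f p q := by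
  rw [Fintype.sum_prod_type, Finset.sum_filter]
  refine Finset.sum_congr rfl fun p _ => ?_
  rw [Finset.sum_filter]
  by_cases hp : (![0, 0, 1, 2, 2, 2] : Fin 6 → Fin 3) p = α
  · rw [if_pos hp]
    refine Finset.sum_congr rfl fun q _ => ?_
    simp only [Prod.mk.injEq, hp, true_and]
  · rw [if_neg hp]
    refine Finset.sum_eq_zero fun q _ => ?_
    simp only [Prod.mk.injEq, hp, false_and, if_false]

/-- **The class moments as double fibre sums.** [this work] -/
theorem classMoment_eq₃₂₁ (U : Fin 6 → Matrix (Fin 2) (Fin 2) ℝ) (η : Fin 6 → ℝ) (m : ℕ) (α β : Fin 3) :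
    ∑ i : Fin 6 × Fin 6, (if ((![0, 0, 1, 2, 2, 2] : Fin 6 → Fin 3) i.1, (![0, 0, 1, 2, 2, 2] : Fin 6 → Fin 3) i.2) = (α, β)
        then polar (U i.1) (U i.2) else 0) * (η i.1 + η i.2) ^ m
      = ∑ p ∈ (if α = 0 then {0, 1} else if α = 1 then {2} else {3, 4, 5} : Finset (Fin 6)),
          ∑ q ∈ (if β = 0 then {0, 1} else if β = 1 then {2} else {3, 4, 5} : Finset (Fin 6)), polar (U p) (U q) * (η p + η q) ^ m := by
  have h := sum_class_eq₃₂₁ (fun p q => polar (U p) (U q) * (η p + η q) ^ m) α β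
  simp only [ite_mul, zero_mul] at h ⊢
  rw [h, weyl321_fib, weyl321_fib]

/-- The pair's fibre enumerated by `![0,1] : Fin 2 → Fin 6`. [this work] -/
theorem sum_fibPair (f : Fin 6 → ℝ) : ∑ p ∈ ({0, 1} : Finset (Fin 6)), f p = ∑ p : Fin 2, f ((![0, 1] : Fin 2 → Fin 6) p) := by
  rw [Finset.sum_insert (by decide), Finset.sum_singleton, Fin.sum_univ_two]
  simp only [Matrix.cons_val_zero, Matrix.cons_val_one]

/-- The single's fibre. [this work] -/
theorem sum_fibSingle (f : Fin 6 → ℝ) : ∑ p ∈ ({2} : Finset (Fin 6)), f p = f 2 := Finset.sum_singleton _ _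

/-- The triple's fibre enumerated by `![3,4,5] : Fin 3 → Fin 6`. [this work] -/
theorem sum_fibTriple (f : Fin 6 → ℝ) : ∑ p ∈ ({3, 4, 5} : Finset (Fin 6)), f p = ∑ p : Fin 3, f ((![3, 4, 5] : Fin 3 → Fin 6) p) := by
  rw [Finset.sum_insert (by decide), Finset.sum_insert (by decide), Finset.sum_singleton, Fin.sum_univ_three]
  simp only [Matrix.cons_val_zero, Matrix.cons_val_one, Matrix.cons_val_two, Matrix.head_cons, Matrix.tail_cons]
  ring

/-- **Swapping a class preserves its moments** (`polar` is symmetric). [this work] -/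
theorem classMoment_swap₃₂₁ (U : Fin 6 → Matrix (Fin 2) (Fin 2) ℝ) (η : Fin 6 → ℝ) (m : ℕ) (k : Fin 3 × Fin 3) :
    ∑ i : Fin 6 × Fin 6, (if ((![0, 0, 1, 2, 2, 2] : Fin 6 → Fin 3) i.1, (![0, 0, 1, 2, 2, 2] : Fin 6 → Fin 3) i.2) = k.swap
        then polar (U i.1) (U i.2) else 0) * (η i.1 + η i.2) ^ m
      = ∑ i : Fin 6 × Fin 6, (if ((![0, 0, 1, 2, 2, 2] : Fin 6 → Fin 3) i.1, (![0, 0, 1, 2, 2, 2] : Fin 6 → Fin 3) i.2) = k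
        then polar (U i.1) (U i.2) else 0) * (η i.1 + η i.2) ^ m := by
  rw [← Equiv.sum_comp (Equiv.prodComm (Fin 6) (Fin 6))]
  refine Finset.sum_congr rfl fun i _ => ?_
  simp only [Equiv.prodComm_apply, Prod.fst_swap, Prod.snd_swap]
  have hiff : (((![0, 0, 1, 2, 2, 2] : Fin 6 → Fin 3) i.2, (![0, 0, 1, 2, 2, 2] : Fin 6 → Fin 3) i.1) = k.swap)
      ↔ (((![0, 0, 1, 2, 2, 2] : Fin 6 → Fin 3) i.1, (![0, 0, 1, 2, 2, 2] : Fin 6 → Fin 3) i.2) = k) := by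
    constructor
    · intro h; have := congrArg Prod.swap h; simpa using this
    · intro h; rw [← h]; rfl
  rw [Bubbling.polar_comm (U i.2) (U i.1), add_comm (η i.2) (η i.1)]
  by_cases h : (((![0, 0, 1, 2, 2, 2] : Fin 6 → Fin 3) i.1, (![0, 0, 1, 2, 2, 2] : Fin 6 → Fin 3) i.2) = k)
  · rw [if_pos h, if_pos (hiff.mpr h)]
  · rw [if_neg h, if_neg (fun h' => h (hiff.mp h'))]

/-- The deviations `η_l = δ_l − δ_{pos (v l)}` vanish at the value positions `0, 2, 3`. [this work] -/
theorem weyl321_eta_pos (δ : Fin 6 → ℝ) (a : Fin 3) :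
    δ ((![0, 2, 3] : Fin 3 → Fin 6) a)
      - δ ((![0, 2, 3] : Fin 3 → Fin 6) ((![0, 0, 1, 2, 2, 2] : Fin 6 → Fin 3) ((![0, 2, 3] : Fin 3 → Fin 6) a))) = 0 := by
  rw [weyl321_v_pos, sub_self]

/-- **Symmetrisation (two letters)**: the four ordered members of a pair's class have the moments of the THREE weighted members `p ≤ q`
(weight `1` on the diagonal, `2` off it) — the member count `K = 3` for #81 `momentTail`. [this work] -/
theorem pairMoment_symmetrise (V : Fin 2 → Matrix (Fin 2) (Fin 2) ℝ) (x : Fin 2 → ℝ) (m : ℕ) :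
    ∑ p, ∑ q, polar (V p) (V q) * (x p + x q) ^ m
      = ∑ pq ∈ (Finset.univ.filter fun pq : Fin 2 × Fin 2 => pq.1 ≤ pq.2),
          ((if pq.1 = pq.2 then 1 else 2) * polar (V pq.1) (V pq.2)) * (x pq.1 + x pq.2) ^ m := by
  have hset : (Finset.univ.filter fun pq : Fin 2 × Fin 2 => pq.1 ≤ pq.2) = {((0 : Fin 2), (0 : Fin 2)), (0, 1), (1, 1)} := by decide
  rw [hset]
  simp only [Fin.sum_univ_two]
  rw [Finset.sum_insert (by decide), Finset.sum_insert (by decide), Finset.sum_singleton]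
  have h01 : polar (V 1) (V 0) = polar (V 0) (V 1) := Bubbling.polar_comm _ _
  simp only [h01, Fin.isValue, if_true, show ((0 : Fin 2) = 1) = False by decide, if_false]
  ring

end Summit.ValiantsHypothesis.ValiantsHypothesis.Theorems.LacunarySymmetroidMatrixDescartes.WallBubbling
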